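import Literature.Probability.Percolation.Z2HalfPlaneThreeArm
import HarnessLib

/-!
# Combinatorial interlacing in the half-plane: loops versus face walks crossing disjoint edges

Topic `Probability/Percolation`.  Two planarity lemmas for the upper half-plane of `ℤ²` with its
moat (faces of height `-1`), in the purely combinatorial form consumed by the collar exploration of
Schramm–Smirnov's mesh-independent gluing (O. Schramm, S. Smirnov, Ann. Probab. 39 (2011),
arXiv:1101.5820, §4, proof of Prop. 4.1, with Lemma 6.2: "three crossings approaching the same
boundary point"): no percolation configuration enters — the hypotheses only say that the face
walks never cross an edge of the primal walk (in the application the primal walk consists of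
examined OPEN edges and the face walks cross examined CLOSED edges, two disjoint sets, while legs
and moat edges are never examinable).

* `Z2HalfPlane.interlace_rect_of_disjoint`, `Z2HalfPlane.interlace_of_disjoint` —
  `Z2HalfPlane.interlace` (rectangular / square box) with "open legs, open path,
  dual-open face walk" replaced by "the face walk crosses no edge of the path and no leg": a face
  walk started at the moat face `(b,-1)` under a primal walk of the half-plane from `(a,0)` to
  `(c,0)`, `a ≤ b < c`, stays in the box of the walk;
* `Z2HalfPlane.interlace_row_rect_of_disjoint`, `Z2HalfPlane.interlace_row_of_disjoint` — the
  same for a face walk started at the ROW-`0` face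
  `(b,0)`, provided the bottom edge `(b,0)–(b+1,0)` under it is not an edge of the primal walk (one
  more face step: the winding numbers of the moat face and of the face above it then agree,
  `walkWinding_eq_walkWinding_up`);
* `Z2HalfPlane.sepEdge_ne_of_openArm` — **two face walks on opposite sides of a primal arm cross
  disjoint edge sets**: if a primal walk climbs from `(x,0)` and leaves the box
  `[x-R₁, x+R₁] × [0, R₁]`, then a face walk from the moat face `(b₁,-1)`, `b₁ < x`, and one from
  `(b₂,-1)`, `x ≤ b₂`, both kept in the smaller face boxes of radius `R` and never crossing an edge
  of the arm or its leg, never cross a common edge (the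
  winding number of leg + arm + a virtual vertical continuation is `1` along the first walk and `0`
  along the second).

Everything is proved; no named fact is introduced.

## References

* O. Schramm, S. Smirnov, Ann. Probab. 39 (2011) 1768–1814, arXiv:1101.5820, §4 and Lemma 6.2.
  [SchrammSmirnov2011]
* W. Werner, *Lectures on two-dimensional critical percolation*, IAS/Park City 16 (2009), Lecture 2,
  first exercise sheet (half-plane arm events: "the right-most point of its cluster on the line").
  [WernerPCMI2009]
* H. Kesten, *Percolation theory for mathematicians* (1982), §2.2 (winding numbers of lattice
  paths). [Kesten1982]
-/

noncomputable section

open SimpleGraph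

namespace Literature.Probability.Percolation

open LatticeModels

namespace Z2HalfPlane

/-! ### Vertical runs (virtual continuations of arms) -/

/-- **A straight upward run** of `n` steps from `(c, t)`: a lattice walk to `(c, t+n)` all of whose
sites have abscissa `c` and height in `[t, t+n]`. [folklore] -/
theorem exists_upRun (c t : ℤ) (n : ℕ) :
    ∃ V : (zdGraph 2).Walk (![c, t] : Site 2) ![c, t + n],
      ∀ w ∈ V.support, w 0 = c ∧ t ≤ w 1 ∧ w 1 ≤ t + n := by
  induction n with
  | zero => exact ⟨Walk.nil.copy rfl (by simp), fun w hw => by simp at hw; subst hw; simp⟩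
  | succ n ih =>
    obtain ⟨V, hV⟩ := ih
    have hadj : (zdGraph 2).Adj (![c, t + n] : Site 2) ![c, t + (n + 1 : ℕ)] :=
      adj_of_stepKind (.up (by simp; ring) (by simp))
    refine ⟨V.append (Walk.cons hadj Walk.nil), fun w hw => ?_⟩
    rw [Walk.support_append, List.mem_append, Walk.support_cons, List.tail_cons, Walk.support_nil,
      List.mem_singleton] at hw
    rcases hw with hw | rfl
    · have := hV w hw; push_cast; omega
    · simp; omega

/-- A property of all sites of a walk holds at both endpoints of each of its edges. [folklore] -/
theorem forall_mem_edges_of_forall_support {u v : Site 2} {V : (zdGraph 2).Walk u v} {Pr : Site 2 → Prop}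
    (hV : ∀ w ∈ V.support, Pr w) {e : Sym2 (Site 2)} (he : e ∈ V.edges) {w : Site 2} (hw : w ∈ e) :
    Pr w := by
  induction e using Sym2.ind with
  | _ p q =>
    rcases Sym2.mem_iff.1 hw with rfl | rfl
    · exact hV _ (V.fst_mem_support_of_mem_edges he)
    · exact hV _ (V.snd_mem_support_of_mem_edges he)

/-- `walkWinding` is invariant under `Walk.copy`. [folklore] -/
@[simp] theorem walkWinding_copy {u v u' v' : Site 2} (q : (zdGraph 2).Walk u v) (hu : u = u') (hv : v = v')
    (w : Site 2) : walkWinding (q.copy hu hv) w = walkWinding q w := by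
  subst hu hv; rfl

/-! ### Small facts on legs and bottom edges -/

/-- The bottom edge `(b,0)–(b+1,0)` is not a leg. [folklore] -/
theorem bottomEdge_ne_leg (b a : ℤ) : s((![b, 0] : Site 2), ![b + 1, 0]) ≠ leg a := by
  intro h
  have : (![a, -1] : Site 2) ∈ s((![b, 0] : Site 2), ![b + 1, 0]) := by rw [h, leg]; exact Sym2.mem_mk_left _ _
  rcases Sym2.mem_iff.1 this with h1 | h1
  · have := congrFun h1 1; simp at this
  · have := congrFun h1 1; simp at this

/-- The bottom edge under the row-`0` face `(b,0)` is the edge separating it from the moat face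
`(b,-1)`, in the form used by `walkWinding_eq_walkWinding_up`. [folklore] -/
theorem moat_up_edge (b : ℤ) :
    s((![b, -1] : Site 2) + Pi.single 1 1, (![b, -1] : Site 2) + Pi.single 1 1 + Pi.single 0 1) =
      s((![b, 0] : Site 2), ![b + 1, 0]) := by
  have h1 : (![b, -1] : Site 2) + Pi.single 1 1 = ![b, 0] := by
    funext i; fin_cases i <;> simp
  have h2 : (![b, 0] : Site 2) + Pi.single 0 1 = ![b + 1, 0] := by
    funext i; fin_cases i <;> simp
  rw [h1, h2]

/-- The step from the moat face `(b,-1)` to `(b,0)` crosses the bottom edge `(b,0)–(b+1,0)`. [folklore] -/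
theorem sepEdge_moat_up (b : ℤ) : sepEdge (![b, -1] : Site 2) ![b, 0] = s((![b, 0] : Site 2), ![b + 1, 0]) := by
  have h1 : (![b, 0] : Site 2) = ![b, -1] + Pi.single 1 1 := by funext i; fin_cases i <;> simp
  conv_lhs => rw [h1]
  rw [sepEdge_up, ← h1]
  congr 1
  funext i; fin_cases i <;> simp

/-! ### Interlacing, combinatorial form -/

/-- **Interlacing (combinatorial form, rectangular box).**  Let `a ≤ b < c` and `P` a lattice walk
from `(a,0)` to `(c,0)` inside `[x₀-M_h, x₀+M_h] × [0, M_v]`.  A face walk started at the moat face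
`(b,-1)`, through faces of height `≥ -1`, none of whose steps crosses an edge of `P` or one of the
legs at `a`, `c`, stays in `[x₀-M_h, x₀+M_h-1] × [-1, M_v-1]`.  (The walk leg–`P`–leg winds `-1`
times around `(b,-1)`, `0` times around far faces, and the winding number is constant along the
face walk.)
[cite: WernerPCMI2009, Lecture 2, first exercise sheet ("Two-arm exponent in the half-plane", 2b)] -/
theorem interlace_rect_of_disjoint {a b c : ℤ} (hab : a ≤ b) (hbc : b < c) {x₀ : ℤ} {Mh Mv : ℕ}
    (P : (zdGraph 2).Walk (![a, 0] : Site 2) ![c, 0])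
    (hP : ∀ z ∈ P.support, 0 ≤ z 1 ∧ z 1 ≤ Mv ∧ x₀ - Mh ≤ z 0 ∧ z 0 ≤ x₀ + Mh)
    {g : Site 2} (Q : (zdGraph 2).Walk (![b, -1] : Site 2) g)
    (hQP : ∀ d ∈ Q.darts, sepEdge d.fst d.snd ∉ P.edges)
    (hQa : ∀ d ∈ Q.darts, sepEdge d.fst d.snd ≠ leg a)
    (hQc : ∀ d ∈ Q.darts, sepEdge d.fst d.snd ≠ leg c)
    (hQ : ∀ z ∈ Q.support, -1 ≤ z 1) :
    x₀ - Mh ≤ g 0 ∧ g 0 + 1 ≤ x₀ + Mh ∧ g 1 + 1 ≤ Mv := by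
  -- the walk `(a,-1) → (a,0) → P → (c,0) → (c,-1)`
  set L : (zdGraph 2).Walk (![a, -1] : Site 2) ![c, -1] :=
    Walk.cons (adj_leg a) (P.append (Walk.cons (adj_leg c).symm Walk.nil)) with hL
  have hLedges : ∀ e ∈ L.edges, e = leg a ∨ e ∈ P.edges ∨ e = leg c := by
    intro e he
    rw [hL, Walk.edges_cons, List.mem_cons, Walk.edges_append, List.mem_append, Walk.edges_cons,
      List.mem_cons] at he
    rcases he with rfl | he | he | he
    · exact Or.inl rfl
    · exact Or.inr (Or.inl he)
    · right; right; rw [he, leg, Sym2.eq_swap]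
    · simp at he
  have hLsupp : ∀ z ∈ L.support, z = ![a, -1] ∨ z = ![c, -1] ∨ z ∈ P.support := by
    intro z hz
    rw [hL, Walk.support_cons, List.mem_cons, Walk.support_append, List.mem_append,
      Walk.support_cons, List.tail_cons, Walk.support_nil, List.mem_singleton] at hz
    tauto
  -- winding around the moat face `(b,-1)` is `-1`
  have hu1 : (![b, -1] : Site 2) 1 = -1 := by simp
  have hWu : walkWinding L ![b, -1] = -1 := by
    rw [hL, walkWinding_cons, walkWinding_append, walkWinding_cons, walkWinding_nil]
    have h1 : stepWinding ![b, -1] ![a, -1] ![a, 0] = 0 := by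
      unfold stepWinding upStep; simp; omega
    have h2 : walkWinding P ![b, -1] = 0 :=
      walkWinding_eq_zero_of_ge (L := 0) (fun z hz => (hP z hz).1) (by rw [hu1]; norm_num)
    have h3 : stepWinding ![b, -1] ![c, 0] ![c, -1] = -1 := by
      unfold stepWinding upStep; simp; omega
    rw [h1, h2, h3]; norm_num
  -- the winding is constant along the face walk
  have hconst : walkWinding L ![b, -1] = walkWinding L g := by
    refine walkWinding_eq_of_faceWalk L Q (fun dq hdq he => ?_) (fun z hz => ?_) (fun z hz => ?_)
    · rcases hLedges _ he with h | h | h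
      · exact hQa dq hdq h
      · exact hQP dq hdq h
      · exact hQc dq hdq h
    · have := hQ z hz
      simp only [mem_rayAbove, not_and]
      intro h; simp at h; omega
    · have := hQ z hz
      simp only [mem_rayAbove, not_and]
      intro h; simp at h; omega
  rw [hWu] at hconst
  -- bounds on the walk
  have hLbd : ∀ z ∈ L.support, -1 ≤ z 1 ∧ z 1 ≤ Mv ∧ x₀ - Mh ≤ z 0 ∧ z 0 ≤ x₀ + Mh := by
    intro z hz
    have ha' := hP _ P.start_mem_support
    have hc' := hP _ P.end_mem_support
    simp at ha' hc'
    rcases hLsupp z hz with rfl | rfl | hz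
    · simp; omega
    · simp; omega
    · have := hP z hz; omega
  have hg1 := hQ g Q.end_mem_support
  refine ⟨?_, ?_, ?_⟩
  · by_contra hlt
    push Not at hlt
    have h := walkWinding_eq_of_left (p := L) (u := g) fun z hz => by have := (hLbd z hz).2.2.1; omega
    rw [← hconst] at h
    unfold aboveInd at h
    simp only [Matrix.cons_val_one, Matrix.cons_val_zero] at h
    split_ifs at h <;> omega
  · by_contra hlt
    push Not at hlt
    have h := walkWinding_eq_zero_of_right (p := L) (u := g) fun z hz => by have := (hLbd z hz).2.2.2; omega
    rw [← hconst] at h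
    norm_num at h
  · by_contra hlt
    push Not at hlt
    have h := walkWinding_eq_zero_of_le (p := L) (u := g) (N := Mv) (fun z hz => (hLbd z hz).2.1) (by omega)
    rw [← hconst] at h
    norm_num at h

/-- **Interlacing (combinatorial form).**  Let `a ≤ b < c` and `P` a lattice walk from `(a,0)` to
`(c,0)` inside `[x₀-M, x₀+M] × [0, M]`.  A face walk started at the moat face `(b,-1)`, through
faces of height `≥ -1`, none of whose steps crosses an edge of `P` or one of the legs at `a`, `c`,
stays in `[x₀-M, x₀+M-1] × [-1, M-1]`.  (The walk leg–`P`–leg winds `-1` times around `(b,-1)`, `0`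
times around far faces, and the winding number is constant along the face walk.)
[cite: WernerPCMI2009, Lecture 2, first exercise sheet ("Two-arm exponent in the half-plane", 2b)] -/
theorem interlace_of_disjoint {a b c : ℤ} (hab : a ≤ b) (hbc : b < c) {x₀ : ℤ} {M : ℕ}
    (P : (zdGraph 2).Walk (![a, 0] : Site 2) ![c, 0])
    (hP : ∀ z ∈ P.support, 0 ≤ z 1 ∧ z 1 ≤ M ∧ x₀ - M ≤ z 0 ∧ z 0 ≤ x₀ + M)
    {g : Site 2} (Q : (zdGraph 2).Walk (![b, -1] : Site 2) g)
    (hQP : ∀ d ∈ Q.darts, sepEdge d.fst d.snd ∉ P.edges)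
    (hQa : ∀ d ∈ Q.darts, sepEdge d.fst d.snd ≠ leg a)
    (hQc : ∀ d ∈ Q.darts, sepEdge d.fst d.snd ≠ leg c)
    (hQ : ∀ z ∈ Q.support, -1 ≤ z 1) :
    x₀ - M ≤ g 0 ∧ g 0 + 1 ≤ x₀ + M ∧ g 1 + 1 ≤ M :=
  interlace_rect_of_disjoint hab hbc (Mh := M) (Mv := M) P hP Q hQP hQa hQc hQ

/-- **Interlacing from a row-`0` face (rectangular box).**  As `interlace_rect_of_disjoint`, for a
face walk started at the face `(b,0)` just above the boundary row, provided the bottom edge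
`(b,0)–(b+1,0)` under it is not an edge of `P` (prepend the face step from the moat).
[cite: WernerPCMI2009, Lecture 2, first exercise sheet ("Two-arm exponent in the half-plane", 2b)] -/
theorem interlace_row_rect_of_disjoint {a b c : ℤ} (hab : a ≤ b) (hbc : b < c) {x₀ : ℤ} {Mh Mv : ℕ}
    (P : (zdGraph 2).Walk (![a, 0] : Site 2) ![c, 0])
    (hP : ∀ z ∈ P.support, 0 ≤ z 1 ∧ z 1 ≤ Mv ∧ x₀ - Mh ≤ z 0 ∧ z 0 ≤ x₀ + Mh)
    {g : Site 2} (Q : (zdGraph 2).Walk (![b, 0] : Site 2) g)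
    (hQP : ∀ d ∈ Q.darts, sepEdge d.fst d.snd ∉ P.edges)
    (hQa : ∀ d ∈ Q.darts, sepEdge d.fst d.snd ≠ leg a)
    (hQc : ∀ d ∈ Q.darts, sepEdge d.fst d.snd ≠ leg c)
    (hQ : ∀ z ∈ Q.support, -1 ≤ z 1)
    (hb : s((![b, 0] : Site 2), ![b + 1, 0]) ∉ P.edges) :
    x₀ - Mh ≤ g 0 ∧ g 0 + 1 ≤ x₀ + Mh ∧ g 1 + 1 ≤ Mv := by
  refine interlace_rect_of_disjoint hab hbc P hP (Walk.cons (adj_leg b) Q) ?_ ?_ ?_ ?_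
  · intro d hd
    rw [Walk.darts_cons, List.mem_cons] at hd
    rcases hd with rfl | hd
    · simpa [sepEdge_moat_up] using hb
    · exact hQP d hd
  · intro d hd
    rw [Walk.darts_cons, List.mem_cons] at hd
    rcases hd with rfl | hd
    · simpa [sepEdge_moat_up] using bottomEdge_ne_leg b a
    · exact hQa d hd
  · intro d hd
    rw [Walk.darts_cons, List.mem_cons] at hd
    rcases hd with rfl | hd
    · simpa [sepEdge_moat_up] using bottomEdge_ne_leg b c
    · exact hQc d hd
  · intro z hz
    rw [Walk.support_cons, List.mem_cons] at hz
    rcases hz with rfl | hz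
    · simp
    · exact hQ z hz

/-- **Interlacing from a row-`0` face.**  As `interlace_of_disjoint`, for a face walk started at the
face `(b,0)` just above the boundary row, provided the bottom edge `(b,0)–(b+1,0)` under it is not
an edge of `P` (prepend the face step from the moat).
[cite: WernerPCMI2009, Lecture 2, first exercise sheet ("Two-arm exponent in the half-plane", 2b)] -/
theorem interlace_row_of_disjoint {a b c : ℤ} (hab : a ≤ b) (hbc : b < c) {x₀ : ℤ} {M : ℕ}
    (P : (zdGraph 2).Walk (![a, 0] : Site 2) ![c, 0])
    (hP : ∀ z ∈ P.support, 0 ≤ z 1 ∧ z 1 ≤ M ∧ x₀ - M ≤ z 0 ∧ z 0 ≤ x₀ + M)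
    {g : Site 2} (Q : (zdGraph 2).Walk (![b, 0] : Site 2) g)
    (hQP : ∀ d ∈ Q.darts, sepEdge d.fst d.snd ∉ P.edges)
    (hQa : ∀ d ∈ Q.darts, sepEdge d.fst d.snd ≠ leg a)
    (hQc : ∀ d ∈ Q.darts, sepEdge d.fst d.snd ≠ leg c)
    (hQ : ∀ z ∈ Q.support, -1 ≤ z 1)
    (hb : s((![b, 0] : Site 2), ![b + 1, 0]) ∉ P.edges) :
    x₀ - M ≤ g 0 ∧ g 0 + 1 ≤ x₀ + M ∧ g 1 + 1 ≤ M :=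
  interlace_row_rect_of_disjoint hab hbc (Mh := M) (Mv := M) P hP Q hQP hQa hQc hQ hb

/-! ### Two face walks on opposite sides of an arm -/

/-- Faces of a face walk on which a winding number is constant: if two face walks carry different
constant values of `walkWinding p`, no step of the one crosses the same edge as a step of the other
(the crossed edge determines the unordered pair of faces, `dualEdge_sepEdge`). [folklore] -/
theorem sepEdge_ne_of_walkWinding_ne {s t : Site 2} (p : (zdGraph 2).Walk s t)
    {f₁ g₁ f₂ g₂ : Site 2} (Q₁ : (zdGraph 2).Walk f₁ g₁) (Q₂ : (zdGraph 2).Walk f₂ g₂) {w₁ w₂ : ℤ}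
    (hne : w₁ ≠ w₂) (h₁ : ∀ z ∈ Q₁.support, walkWinding p z = w₁)
    (h₂ : ∀ z ∈ Q₂.support, walkWinding p z = w₂) :
    ∀ d₁ ∈ Q₁.darts, ∀ d₂ ∈ Q₂.darts, sepEdge d₁.fst d₁.snd ≠ sepEdge d₂.fst d₂.snd := by
  intro d₁ hd₁ d₂ hd₂ heq
  have hpair : s(d₁.fst, d₁.snd) = s(d₂.fst, d₂.snd) := by
    rw [← dualEdge_sepEdge d₁.adj, ← dualEdge_sepEdge d₂.adj, heq]
  have hmem : d₂.fst ∈ s(d₁.fst, d₁.snd) := by rw [hpair]; exact Sym2.mem_mk_left _ _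
  have hQ₁ : d₂.fst ∈ Q₁.support := by
    rcases Sym2.mem_iff.1 hmem with h | h
    · rw [h]; exact Q₁.dart_fst_mem_support_of_mem_darts hd₁
    · rw [h]; exact Q₁.dart_snd_mem_support_of_mem_darts hd₁
  exact hne ((h₁ _ hQ₁).symm.trans (h₂ _ (Q₂.dart_fst_mem_support_of_mem_darts hd₂)))

/-- **Two face walks on opposite sides of a primal arm cross disjoint edge sets.**  Let `P` be a
lattice walk of the half-plane from `(x,0)` inside `B₁ = [x-R₁, x+R₁] × [0, R₁]` to a site `y`
adjacent to a site `z ∉ B₁` of height `≥ 0` (the arm leaves the box through the edge `yz`).  Let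
`Q₁`, `Q₂` be face walks from the moat faces `(b₁,-1)`, `b₁ < x`, and `(b₂,-1)`, `x ≤ b₂`, through
faces of height in `[-1, R]` and abscissa in `[x-R₁+2, x+R₁-2]`, `R + 1 ≤ R₁`, whose steps never
cross an edge of `P`, the exit edge `yz`, or the leg at `x`.  Then no step of `Q₁` crosses the same
edge as a step of `Q₂`: the winding number of leg–`P`–`yz`–(vertical run up from `z`) is `1` on
every face of `Q₁` and `0` on every face of `Q₂`.
[cite: SchrammSmirnov2011, §4, proof of Prop. 4.1 with Lemma 6.2 (the three crossings are disjoint)] -/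
theorem sepEdge_ne_of_openArm {x b₁ b₂ : ℤ} (hb₁ : b₁ < x) (hb₂ : x ≤ b₂) {R R₁ : ℕ} (hRR₁ : R + 1 ≤ R₁)
    {y z : Site 2} (P : (zdGraph 2).Walk (![x, 0] : Site 2) y)
    (hP : ∀ w ∈ P.support, 0 ≤ w 1 ∧ w 1 ≤ R₁ ∧ x - R₁ ≤ w 0 ∧ w 0 ≤ x + R₁)
    (hyz : (zdGraph 2).Adj y z) (hz : ¬ (0 ≤ z 1 ∧ z 1 ≤ R₁ ∧ x - R₁ ≤ z 0 ∧ z 0 ≤ x + R₁)) (hz0 : 0 ≤ z 1)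
    {g₁ g₂ : Site 2} (Q₁ : (zdGraph 2).Walk (![b₁, -1] : Site 2) g₁)
    (Q₂ : (zdGraph 2).Walk (![b₂, -1] : Site 2) g₂)
    (hQ₁ : ∀ u ∈ Q₁.support, -1 ≤ u 1 ∧ u 1 ≤ R ∧ x - R₁ + 2 ≤ u 0 ∧ u 0 + 2 ≤ x + R₁)
    (hQ₂ : ∀ u ∈ Q₂.support, -1 ≤ u 1 ∧ u 1 ≤ R ∧ x - R₁ + 2 ≤ u 0 ∧ u 0 + 2 ≤ x + R₁)
    (hQ₁P : ∀ d ∈ Q₁.darts, sepEdge d.fst d.snd ∉ P.edges ∧ sepEdge d.fst d.snd ≠ s(y, z) ∧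
      sepEdge d.fst d.snd ≠ leg x)
    (hQ₂P : ∀ d ∈ Q₂.darts, sepEdge d.fst d.snd ∉ P.edges ∧ sepEdge d.fst d.snd ≠ s(y, z) ∧
      sepEdge d.fst d.snd ≠ leg x) :
    ∀ d₁ ∈ Q₁.darts, ∀ d₂ ∈ Q₂.darts, sepEdge d₁.fst d₁.snd ≠ sepEdge d₂.fst d₂.snd := by
  -- the virtual continuation: straight up from `z` by `R₁ + 2`
  have hz' : z = ![z 0, z 1] := by funext i; fin_cases i <;> rfl
  obtain ⟨V, hV⟩ := exists_upRun (z 0) (z 1) (R₁ + 2)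
  -- the primal walk `p = leg ; P ; yz ; V`
  set p : (zdGraph 2).Walk (![x, -1] : Site 2) ![z 0, z 1 + (R₁ + 2 : ℕ)] :=
    Walk.cons (adj_leg x) (P.append (Walk.cons hyz (V.copy hz'.symm rfl))) with hp
  have hy := hP y P.end_mem_support
  -- edges of `p`
  have hpedges : ∀ e ∈ p.edges, e = leg x ∨ e ∈ P.edges ∨ e = s(y, z) ∨ e ∈ V.edges := by
    intro e he
    rw [hp, Walk.edges_cons, List.mem_cons, Walk.edges_append, List.mem_append, Walk.edges_cons,
      List.mem_cons, Walk.edges_copy] at he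
    tauto
  -- `z` is on the rim of the box
  have hzrim : z 1 = R₁ + 1 ∨ z 0 = x + R₁ + 1 ∨ z 0 = x - R₁ - 1 := by
    push Not at hz
    rcases stepKind_of_adj hyz with ⟨e0, e1⟩ | ⟨e0, e1⟩ | ⟨e1, e0⟩ | ⟨e1, e0⟩ <;> omega
  -- endpoints of edges of the vertical run
  have hVe : ∀ e ∈ V.edges, ∀ w ∈ e, w 0 = z 0 ∧ z 1 ≤ w 1 := fun e he w hw =>
    ⟨(forall_mem_edges_of_forall_support hV he hw).1, (forall_mem_edges_of_forall_support hV he hw).2.1⟩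
  -- no face step of a walk in the face boxes crosses an edge of `p`
  have hcross : ∀ {f g : Site 2} (Q : (zdGraph 2).Walk f g),
      (∀ u ∈ Q.support, -1 ≤ u 1 ∧ u 1 ≤ R ∧ x - R₁ + 2 ≤ u 0 ∧ u 0 + 2 ≤ x + R₁) →
      (∀ d ∈ Q.darts, sepEdge d.fst d.snd ∉ P.edges ∧ sepEdge d.fst d.snd ≠ s(y, z) ∧
        sepEdge d.fst d.snd ≠ leg x) →
      ∀ d ∈ Q.darts, sepEdge d.fst d.snd ∉ p.edges := by
    intro f g Q hQ hQP d hd he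
    rcases hpedges _ he with h | h | h | h
    · exact (hQP d hd).2.2 h
    · exact (hQP d hd).1 h
    · exact (hQP d hd).2.1 h
    · have hf := hQ _ (Q.dart_fst_mem_support_of_mem_darts hd)
      have hs := hQ _ (Q.dart_snd_mem_support_of_mem_darts hd)
      have hmem : sepLo d.fst d.snd ∈ sepEdge d.fst d.snd := Sym2.mem_mk_left _ _
      have h0 := sepEdge_apply_zero_le hmem
      have h1 := sepEdge_apply_one_le hmem
      have hw := hVe _ h _ hmem
      rcases hzrim with hz1 | hz1 | hz1
      · have : max (d.toProd.1 1) (d.toProd.2 1) ≤ R := max_le hf.2.1 hs.2.1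
        omega
      · have : max (d.toProd.1 0) (d.toProd.2 0) + 2 ≤ x + R₁ := by
          rcases le_total (d.toProd.1 0) (d.toProd.2 0) with hle | hle
          · rw [max_eq_right hle]; exact hs.2.2.2
          · rw [max_eq_left hle]; exact hf.2.2.2
        omega
      · have : x - R₁ + 2 ≤ max (d.toProd.1 0) (d.toProd.2 0) := hf.2.2.1.trans (le_max_left _ _)
        omega
  -- winding of `p` around a moat face `(b,-1)`: `[b + 1 ≤ x]`
  have hWmoat : ∀ b : ℤ, walkWinding p ![b, -1] = if b + 1 ≤ x then 1 else 0 := by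
    intro b
    rw [hp, walkWinding_cons, walkWinding_append, walkWinding_cons, walkWinding_copy]
    have h1 : stepWinding ![b, -1] ![x, -1] ![x, 0] = if b + 1 ≤ x then 1 else 0 := by
      rw [stepWinding_up (by simp) (by simp)]
      simp
    have h2 : walkWinding P ![b, -1] = 0 :=
      walkWinding_eq_zero_of_ge (L := 0) (fun w hw => (hP w hw).1) (by simp)
    have h3 : stepWinding ![b, -1] y z = 0 := by
      rcases stepKind_of_adj hyz with ⟨e0, e1⟩ | ⟨e0, e1⟩ | ⟨e1, e0⟩ | ⟨e1, e0⟩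
      · exact stepWinding_right e0
      · exact stepWinding_left e0
      · rw [stepWinding_up e1 e0]; simp; omega
      · rw [stepWinding_down e1 e0]; simp; omega
    have h4 : walkWinding V ![b, -1] = 0 :=
      walkWinding_eq_zero_of_ge (L := 0) (fun w hw => by have := (hV w hw).2.1; omega) (by simp)
    rw [h1, h2, h3, h4]; simp
  -- endpoints of `p` are off every ray above a face of the face boxes
  have hray_s : ∀ u : Site 2, -1 ≤ u 1 → (![x, -1] : Site 2) ∉ rayAbove u := by
    intro u hu h; rw [mem_rayAbove] at h; simp at h; omega
  have hray_t : ∀ u : Site 2, u 1 ≤ R → (![z 0, z 1 + (R₁ + 2 : ℕ)] : Site 2) ∉ rayAbove u := by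
    intro u hu h; rw [mem_rayAbove] at h; simp at h; omega
  -- constancy along the two face walks
  have hW₁ : ∀ u ∈ Q₁.support, walkWinding p u = 1 := by
    intro u hu
    have hsub : ∀ d ∈ (Q₁.takeUntil u hu).darts, d ∈ Q₁.darts := fun d hd => Q₁.darts_takeUntil_subset_darts hu hd
    have := walkWinding_eq_of_faceWalk p (Q₁.takeUntil u hu)
      (fun d hd => hcross Q₁ hQ₁ hQ₁P d (hsub d hd))
      (fun w hw => hray_s w (hQ₁ w (Q₁.support_takeUntil_subset_support hu hw)).1)
      (fun w hw => hray_t w (hQ₁ w (Q₁.support_takeUntil_subset_support hu hw)).2.1)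
    rw [← this, hWmoat b₁]
    simp [show b₁ + 1 ≤ x by omega]
  have hW₂ : ∀ u ∈ Q₂.support, walkWinding p u = 0 := by
    intro u hu
    have hsub : ∀ d ∈ (Q₂.takeUntil u hu).darts, d ∈ Q₂.darts := fun d hd => Q₂.darts_takeUntil_subset_darts hu hd
    have := walkWinding_eq_of_faceWalk p (Q₂.takeUntil u hu)
      (fun d hd => hcross Q₂ hQ₂ hQ₂P d (hsub d hd))
      (fun w hw => hray_s w (hQ₂ w (Q₂.support_takeUntil_subset_support hu hw)).1)
      (fun w hw => hray_t w (hQ₂ w (Q₂.support_takeUntil_subset_support hu hw)).2.1)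
    rw [← this, hWmoat b₂]
    simp [show ¬ (b₂ + 1 ≤ x) by omega]
  exact sepEdge_ne_of_walkWinding_ne p Q₁ Q₂ one_ne_zero hW₁ hW₂

end Z2HalfPlane

end Literature.Probability.Percolation
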